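import Literature.NumberTheory.EllipticCurves.FormalGroupLaurentPoints
import HarnessLib

/-!
# Formal points over Laurent-series fields in every characteristic: the doubling case without
# `char k ≠ 2` (proofs only)

Topic `NumberTheory/EllipticCurves` (theorems only; no definition, no named fact). Sequel of
`FormalGroupLaurentPoints`, whose dictionary "the formal group law computes `E(k⸨X⸩)`"
(`laurentPt_formalGroupLaw`, `laurentPt_formalMul`) carries the hypothesis `(2 : k) ≠ 0`, used at
exactly one place: in the tangent case `laurentPt_add_self`, to see that the formal point `P(σ)` is
not a `2`-torsion point, i.e. that `Ỹ(σ) = (a₁σ − 2)X(σ) + a₃σ³ = σ³(2y + a₁x + a₃) ≠ 0`, from its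
constant term `−2`. This file removes the hypothesis: in characteristic `2`,
`Ỹ(σ) = σ · (a₁X(σ) + a₃σ²)` is still nonzero for an ELLIPTIC reduction, because `a₁ = a₃ = 0`
together with `2 = 0` forces `Δ = 0` (`b₂ = b₄ = b₆ = 0 (mod 2)`, so every monomial of `Δ` is even)
— `formalYTilde_subst_ne_zero`. The rest of the tangent computation (`chart_doubleX/Y`, Mathlib's
duplication formulas) is characteristic-free, so `laurentPt_add_self'`, `laurentPt_formalGroupLaw'`
and `laurentPt_formalMul'` hold over every field `k` for the reduction `V ⊗ k` of a Weierstrass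
curve `V/ℤ_p` with elliptic fibres. Consequence (sequel files): Honda's congruences for `log_E`,
the finite height `[p]˜ ≠ 0` and Honda's strong isomorphism at a GOOD prime hold at `p = 2` as well
(the "types at good `p = 2`" missing from the finite-height route to the integrality of the Manin
constant, `NeronIsogenyScaling.lean`).

## References

* J. H. Silverman, *The Arithmetic of Elliptic Curves*, GTM 106, 2nd ed. (2009), III.1 (the
  quantities `bᵢ`, `Δ`), III.2.3, IV.1–IV.2, VII.2.2, App. A (Prop. 1.1: curves in characteristic
  `2`, `a₁ = a₃ = 0 ⇒ Δ = 0`). [cite: SilvermanAEC2009]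
* T. Honda, *On the theory of commutative formal groups*, J. Math. Soc. Japan 22 (1970), §6.2.
  [Honda1970]
-/

noncomputable section

open scoped Classical

namespace WeierstrassCurve

open scoped LaurentSeries
open PowerSeries Literature.NumberTheory.EllipticCurves

/-! ### `a₁ = a₃ = 0` and `2 = 0` force `Δ = 0` -/

section CharTwo

variable {R : Type*} [CommRing R] (E : WeierstrassCurve R)

/-- **In characteristic `2`, `a₁ = a₃ = 0` forces `Δ = 0`**: with `a₁ = a₃ = 0` one has
`b₂ = 4a₂`, `b₄ = 2a₄`, `b₆ = 4a₆`, and every monomial of `Δ = −b₂²b₈ − 8b₄³ − 27b₆² + 9b₂b₄b₆` is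
divisible by `2`. (Silverman, App. A: a Weierstrass cubic with `a₁ = a₃ = 0` is singular in
characteristic `2`.) [cite: SilvermanAEC2009, III.1 and App. A Prop. 1.1] -/
theorem Δ_eq_zero_of_a₁_a₃_two (h₁ : E.a₁ = 0) (h₃ : E.a₃ = 0) (h2 : (2 : R) = 0) : E.Δ = 0 := by
  simp only [WeierstrassCurve.Δ, WeierstrassCurve.b₂, WeierstrassCurve.b₄, WeierstrassCurve.b₆,
    WeierstrassCurve.b₈, h₁, h₃]
  linear_combination (-8 * E.a₂ ^ 2 * (4 * E.a₂ * E.a₆ - E.a₄ ^ 2) - 32 * E.a₄ ^ 3 - 216 * E.a₆ ^ 2 +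
    144 * E.a₂ * E.a₄ * E.a₆) * h2

/-- For an elliptic curve over a ring with `2 = 0`, `a₁ ≠ 0` or `a₃ ≠ 0`. [cite: SilvermanAEC2009, App. A Prop. 1.1] -/
theorem a₁_ne_zero_or_a₃_ne_zero_of_two [Nontrivial R] [E.IsElliptic] (h2 : (2 : R) = 0) :
    E.a₁ ≠ 0 ∨ E.a₃ ≠ 0 := by
  by_contra h
  rw [not_or, not_not, not_not] at h
  exact E.isUnit_Δ.ne_zero (E.Δ_eq_zero_of_a₁_a₃_two h.1 h.2 h2)

end CharTwo

/-! ### `Ỹ(σ) ≠ 0` in every characteristic -/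

section YTilde

variable {p : ℕ} [Fact p.Prime] (V : WeierstrassCurve ℤ_[p])
  {k : Type*} [Field k] (φ : ℤ_[p] →+* k) [hEk : (V.map φ).IsElliptic]

/-- **`Ỹ(σ) = (a₁σ − 2)X(σ) + a₃σ³ ≠ 0` for `σ ≠ 0`, in every characteristic** (the formal point
`P(σ)` is not a `2`-torsion point: `Ỹ(σ) = σ³(2y + a₁x + a₃)`). If `2 ≠ 0` in `k` the constant
term is `−2 ≠ 0` (`constantCoeff_formalYTilde_subst`); if `2 = 0`, `Ỹ(σ) = σ(a₁X(σ) + a₃σ²)` with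
`X(σ) = 1 + ⋯`, whose vanishing would force `a₁ = 0` (constant term) and then `a₃ = 0` (`σ² ≠ 0`),
contradicting ellipticity of the reduction (`a₁_ne_zero_or_a₃_ne_zero_of_two`).
[cite: SilvermanAEC2009, III.2.3 and App. A Prop. 1.1] -/
theorem formalYTilde_subst_ne_zero {σ : k⟦X⟧} (hσ0 : constantCoeff σ = 0) (hσ : σ ≠ 0) :
    (C (φ V.a₁) * σ - 2) * (V.map φ).formalXMulSq.subst σ + C (φ V.a₃) * σ ^ 3 ≠ 0 := by
  intro h0
  by_cases h2 : (2 : k) = 0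
  · -- characteristic `2`
    have h2' : (2 : k⟦X⟧) = 0 := by rw [← map_ofNat (C : k →+* k⟦X⟧) 2, h2, map_zero]
    set A : k⟦X⟧ := (V.map φ).formalXMulSq.subst σ with hA
    have hA1 : constantCoeff A = 1 := constantCoeff_formalXMulSq_subst hσ0
    have hfac : σ * (C (φ V.a₁) * A + C (φ V.a₃) * σ ^ 2) = 0 := by
      rw [h2', sub_zero] at h0
      linear_combination h0
    have hin : C (φ V.a₁) * A + C (φ V.a₃) * σ ^ 2 = 0 := (mul_eq_zero.mp hfac).resolve_left hσ
    have ha₁ : φ V.a₁ = 0 := by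
      have hc := congrArg constantCoeff hin
      rwa [map_add, map_mul, map_mul, constantCoeff_C, constantCoeff_C, hA1, map_pow, hσ0,
        zero_pow two_ne_zero, mul_zero, add_zero, mul_one, map_zero] at hc
    have ha₃ : φ V.a₃ = 0 := by
      rw [ha₁, map_zero, zero_mul, zero_add] at hin
      rcases mul_eq_zero.mp hin with h | h
      · have hc := congrArg constantCoeff h
        rwa [constantCoeff_C, map_zero] at hc
      · exact absurd (pow_eq_zero_iff two_ne_zero |>.mp h) hσ
    rcases (V.map φ).a₁_ne_zero_or_a₃_ne_zero_of_two h2 with h | h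
    · exact h (by rw [map_a₁, ha₁])
    · exact h (by rw [map_a₃, ha₃])
  · -- characteristic `≠ 2`: constant term `−2`
    have := V.constantCoeff_formalYTilde_subst φ hσ0
    rw [h0, map_zero] at this
    exact h2 (by linear_combination this)

end YTilde

/-! ### The tangent case and the dictionary, in every characteristic -/

section LaurentAdd

variable {p : ℕ} [Fact p.Prime] (V : WeierstrassCurve ℤ_[p]) [hE : (V.map PadicInt.Coe.ringHom).IsElliptic]
  {k : Type*} [Field k] (φ : ℤ_[p] →+* k) [hEk : (V.map φ).IsElliptic]

/-- **`P(σ) + P(σ) = P([2](σ))` in every characteristic** (the tangent case): as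
`laurentPt_add_self`, with the non-`2`-torsion of `P(σ)` now supplied by
`formalYTilde_subst_ne_zero` (ellipticity of the reduction) instead of `(2 : k) ≠ 0`; Mathlib's
tangent `(addX, addY)` is the formal point of parameter `[2](σ)` by
`formalXMulSq_formalMul_two(Y)_subst`. [Silverman AEC III.2.3 (duplication), IV.2, VII.2.2]
[cite: SilvermanAEC2009, IV.2] -/
theorem laurentPt_add_self' {σ : k⟦X⟧} (hσ0 : constantCoeff σ = 0) (hσ : σ ≠ 0) :
    (V.map φ).laurentPt σ hσ0 + (V.map φ).laurentPt σ hσ0 =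
      (V.map φ).laurentPt (((V.map φ).formalMul 2).subst σ)
        (Literature.RingTheory.FormalGroups.constantCoeff_subst_of_constantCoeff_eq_zero hσ0 _ |>.trans
          ((V.map φ).constantCoeff_formalMul 2)) := by
  set E := V.map φ with hEdef
  set D : k⟦X⟧ := (E.formalMul 2).subst σ with hDdef
  have keyX := congrArg (fun f : k⟦X⟧ => (f : k⸨X⸩)) (V.formalXMulSq_formalMul_two_subst φ hσ0)
  have keyY := congrArg (fun f : k⟦X⟧ => (f : k⸨X⸩)) (V.formalXMulSq_formalMul_twoY_subst φ hσ0)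
  simp only [PowerSeries.coe_mul, PowerSeries.coe_pow, PowerSeries.coe_add, PowerSeries.coe_sub,
    PowerSeries.coe_neg] at keyX keyY
  have c2 : ((2 : k⟦X⟧) : k⸨X⸩) = 2 := by rw [← map_ofNat (C : k →+* k⟦X⟧) 2, PowerSeries.coe_C]; rfl
  have c3 : ((3 : k⟦X⟧) : k⸨X⸩) = 3 := by rw [← map_ofNat (C : k →+* k⟦X⟧) 3, PowerSeries.coe_C]; rfl
  rw [c2, c3] at keyX keyY
  rw [← hEdef, ← hDdef] at keyX keyY
  have hsc := coe_laurent_ne_zero hσ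
  -- `Ỹ(σ) ≠ 0`, i.e. `P(σ)` is not `2`-torsion (every characteristic)
  set Yt : k⟦X⟧ := (C (φ V.a₁) * σ - 2) * E.formalXMulSq.subst σ + C (φ V.a₃) * σ ^ 3 with hYtdef
  have hYt0 : Yt ≠ 0 := V.formalYTilde_subst_ne_zero φ hσ0 hσ
  have hYtc : ((Yt : k⟦X⟧) : k⸨X⸩) ≠ 0 := coe_laurent_ne_zero hYt0
  have hYte : ((Yt : k⟦X⟧) : k⸨X⸩) = ((σ : k⟦X⟧) : k⸨X⸩) ^ 3 *
      (E.laurentY σ - (E.baseChange k⸨X⸩).toAffine.negY (E.laurentX σ) (E.laurentY σ)) := by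
    rw [hYtdef, PowerSeries.coe_add, PowerSeries.coe_mul, PowerSeries.coe_mul, PowerSeries.coe_sub,
      PowerSeries.coe_mul, PowerSeries.coe_pow, c2]
    simp only [Affine.negY, baseChange, map_a₁, map_a₃, algebraMap_laurentSeries_eq_coe_C, laurentX, laurentY, hEdef]
    exact formalYTilde_chart _ _ _ _ hsc
  have hy : E.laurentY σ ≠ (E.baseChange k⸨X⸩).toAffine.negY (E.laurentX σ) (E.laurentY σ) := by
    intro h
    apply hYtc
    rw [hYte, sub_eq_zero.mpr h, mul_zero]
  -- `D ≠ 0`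
  have hD0 : D ≠ 0 := by
    intro hD
    rw [hD, formalXMulSq_subst_zero, PowerSeries.coe_one, PowerSeries.coe_zero] at keyX
    have : ((σ : k⟦X⟧) : k⸨X⸩) ^ 2 * ((Yt : k⟦X⟧) : k⸨X⸩) ^ 2 = 0 := by
      rw [hYtdef, PowerSeries.coe_add, PowerSeries.coe_mul, PowerSeries.coe_mul, PowerSeries.coe_sub,
        PowerSeries.coe_mul, PowerSeries.coe_pow, c2]
      linear_combination keyX
    simp only [mul_eq_zero, pow_eq_zero_iff, ne_eq, OfNat.ofNat_ne_zero, not_false_eq_true] at this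
    rcases this with h | h
    · exact hsc h
    · exact hYtc h
  have hDc := coe_laurent_ne_zero hD0
  -- the points
  rw [laurentPt_of_ne_zero hσ0 hσ, laurentPt_of_ne_zero _ hD0, Affine.Point.add_self_of_Y_ne hy]
  simp only [Affine.Point.some.injEq]
  have hcX := chart_doubleX hsc hDc keyX
  have hcY := chart_doubleY hsc hDc keyY
  have htanX := tangent_addX_mul (E.baseChange k⸨X⸩) hy
  have htanY := tangent_addY_mul (E.baseChange k⸨X⸩) hy
  simp only [baseChange, map_a₁, map_a₂, map_a₃, map_a₄, algebraMap_laurentSeries_eq_coe_C, hEdef] at htanX htanY hcX hcY hy ⊢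
  simp only [laurentX, laurentY, Affine.negY] at htanX htanY hy ⊢
  have hDy : -(((V.map φ).formalXMulSq.subst σ : k⟦X⟧) : k⸨X⸩) / ((σ : k⟦X⟧) : k⸨X⸩) ^ 3 -
      (-(-(((V.map φ).formalXMulSq.subst σ : k⟦X⟧) : k⸨X⸩) / ((σ : k⟦X⟧) : k⸨X⸩) ^ 3) -
        ((C (φ V.a₁) : k⟦X⟧) : k⸨X⸩) * ((((V.map φ).formalXMulSq.subst σ : k⟦X⟧) : k⸨X⸩) /
          ((σ : k⟦X⟧) : k⸨X⸩) ^ 2) - ((C (φ V.a₃) : k⟦X⟧) : k⸨X⸩)) ≠ 0 := sub_ne_zero.mpr hy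
  have hX3 := mul_right_cancel₀ (pow_ne_zero 2 hDy) (htanX.trans hcX.symm)
  refine ⟨hX3, ?_⟩
  rw [hX3] at htanY
  have hY3 := mul_right_cancel₀ hDy (htanY.trans hcY.symm)
  linear_combination hY3

/-- **The formal group law computes the group law of the formal points, `P(F(σ, τ)) = P(σ) + P(τ)`,
in every characteristic** — as `laurentPt_formalGroupLaw`, with the tangent case from
`laurentPt_add_self'`. [cite: SilvermanAEC2009, Prop. VII.2.2] -/
theorem laurentPt_formalGroupLaw' {σ τ : k⟦X⟧} (hσ0 : constantCoeff σ = 0)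
    (hτ0 : constantCoeff τ = 0) :
    (V.map φ).laurentPt (MvPowerSeries.subst ![σ, τ] (V.map φ).formalGroupLaw)
        (constantCoeff_formalGroupLaw_subst_pair V φ hσ0 hτ0) =
      (V.map φ).laurentPt σ hσ0 + (V.map φ).laurentPt τ hτ0 := by
  set E := V.map φ with hEdef
  by_cases hσ : σ = 0
  · subst hσ
    rw [laurentPt_zero, zero_add]
    exact laurentPt_congr (E.formalGroupLaw_subst_zero (PowerSeries.HasSubst.of_constantCoeff_zero' hτ0)) _ _
  by_cases hτ : τ = 0
  · subst hτ
    rw [laurentPt_zero, add_zero]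
    exact laurentPt_congr (formalGroupLaw_subst_pair_zero_right hσ0) _ _
  by_cases hx : E.laurentX σ = E.laurentX τ
  · rcases Affine.Y_eq_of_X_eq (laurent_equation hσ0 hσ) (laurent_equation hτ0 hτ) hx with hy | hy
    · -- `P(τ) = P(σ)`, so `τ = σ`: tangent case
      have hστ : σ = τ := by
        refine laurentPt_injective (E := E) hσ0 hτ0 ?_
        rw [laurentPt_of_ne_zero hσ0 hσ, laurentPt_of_ne_zero hτ0 hτ]
        simp only [Affine.Point.some.injEq]
        exact ⟨hx, hy⟩
      subst hστ
      rw [laurentPt_add_self' V φ hσ0 hσ]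
      exact laurentPt_congr (V.formalMul_two_subst φ hσ0).symm _ _
    · -- `P(τ) = -P(σ)`, so `τ = i(σ)`
      have hτi : τ = E.formalNeg.subst σ := by
        refine laurentPt_injective (E := E) hτ0 (constantCoeff_formalNeg_subst hσ0) ?_
        rw [← neg_laurentPt hσ0, laurentPt_of_ne_zero hσ0 hσ, laurentPt_of_ne_zero hτ0 hτ,
          Affine.Point.neg_some]
        simp only [Affine.Point.some.injEq]
        exact ⟨hx.symm, by rw [hy, ← hx, Affine.negY_negY]⟩
      subst hτi
      rw [← neg_laurentPt hσ0, add_neg_cancel]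
      rw [laurentPt_congr (formalGroupLaw_subst_pair_formalNeg hσ0) _ (map_zero _), laurentPt_zero]
  · exact (V.laurentPt_add_of_laurentX_ne φ hσ0 hτ0 hσ hτ hx).symm

/-- **`P([n](σ)) = n • P(σ)` in every characteristic** — as `laurentPt_formalMul`.
[cite: SilvermanAEC2009, Prop. VII.2.2] -/
theorem laurentPt_formalMul' (n : ℕ) {σ : k⟦X⟧} (hσ0 : constantCoeff σ = 0) :
    (V.map φ).laurentPt (((V.map φ).formalMul n).subst σ)
        ((Literature.RingTheory.FormalGroups.constantCoeff_subst_of_constantCoeff_eq_zero hσ0 _).trans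
          ((V.map φ).constantCoeff_formalMul n)) =
      n • (V.map φ).laurentPt σ hσ0 := by
  induction n with
  | zero =>
    rw [zero_nsmul]
    have h0 : ((V.map φ).formalMul 0).subst σ = 0 := by
      rw [formalMul_zero, ← PowerSeries.coe_substAlgHom (PowerSeries.HasSubst.of_constantCoeff_zero' hσ0),
        map_zero]
    rw [laurentPt_congr h0 _ (map_zero _), laurentPt_zero]
  | succ n ih =>
    rw [succ_nsmul, ← ih, laurentPt_congr (formalMul_succ_subst n hσ0) _
      (constantCoeff_formalGroupLaw_subst_pair V φ
        ((Literature.RingTheory.FormalGroups.constantCoeff_subst_of_constantCoeff_eq_zero hσ0 _).trans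
          ((V.map φ).constantCoeff_formalMul n)) hσ0), laurentPt_formalGroupLaw' V φ]

end LaurentAdd

end WeierstrassCurve
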